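import Summits.Ventures.CertifiedArithmetic.LowPrec.DoubleRoundingSqrtMatrix
import Summits.Ventures.CertifiedArithmetic.LowPrec.DoubleRoundingGmidBelow

/-!
# Below the underflow clause of the square root, I: the integer heart and the finest grid

HONEST FRAMING: certified error envelopes and provably optimal rounding/accumulation schemes for
low-precision formats under stated cost models; every table by two implementations; no hardware or
vendor claims.

Support file of THEOREM D-sqrt-U′ / LAW N-sqrt-U′ (`DoubleRoundingSqrtUnderflow.lean`, which
carries the statement, the proof outline and the literature placement). §1 is the integer heart
`sqrt_low_core` of the new branch of the slip anatomy (a midpoint of `φ` that is SUBNORMAL in the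
fine format `ψ`): in units of `quantum_ψ/2`, `4^G ∣ Z - M² ≠ 0` and `|Z - M²| ≤ 2M + 1` bound the
binade-plus-depth `G ≤ m + 2`. §2 has two record-generic rounding facts on the finest grid used
by the failure family: a rational within half a quantum of a value rounds to it
(`toRat_roundNE_of_abs_lt_half`), and the finest-zone tie above an odd significand rounds up
(`toRat_roundNE_fine_mid_odd`, companion of `toRat_roundNE_gmid_odd`). [this packet]
-/

namespace Summit.Ventures.CertifiedArithmetic

open Literature.ComputerArithmetic.FloatingPoint
open Literature.ComputerArithmetic.FloatingPoint.Format
open Literature.ComputerArithmetic.FloatingPoint.MiniFloat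

/-! ## §1 The integer heart below the underflow clause -/

/-- THE INTEGER HEART OF THEOREM D-sqrt-U′. In units of `ν = quantum_ψ / 2`, a midpoint
`M = (2V+1) 2^G` of `φ` (`V < 2^(m+1)`) in the region where `ψ` has spacing `2ν` catches the root
of an operand `Z = A 2^κ` (`A < 2^(m+1)`) only if `(M-1)² ≤ Z ≤ (M+1)²`, `Z ≠ M²`; when `4^G ∣ Z`
(`2G ≤ κ`, automatic for a normal midpoint `2^m ≤ V`) this forces `G ≤ m + 2`:
`4^G ∣ Z - M² ≠ 0` while `|Z - M²| ≤ 2M + 1 < 2^(m+3+G)`. [this packet] -/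
theorem sqrt_low_core {m G κ V A : ℕ} {M : ℤ} (hA : (A : ℤ) < 2 ^ (m + 1))
    (hV : (V : ℤ) < 2 ^ (m + 1)) (hM : M = (2 * V + 1) * 2 ^ G) (hκ : 2 * G ≤ κ ∨ 2 ^ m ≤ V)
    (hZlo : (M - 1) ^ 2 ≤ (A : ℤ) * 2 ^ κ) (hZhi : (A : ℤ) * 2 ^ κ ≤ (M + 1) ^ 2)
    (hne : (A : ℤ) * 2 ^ κ ≠ M ^ 2) : G ≤ m + 2 := by
  have two_pow_lt : ∀ {i j : ℕ}, (2:ℤ) ^ i < 2 ^ j → i < j := fun h =>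
    (pow_lt_pow_iff_right₀ (by norm_num : (1:ℤ) < 2)).mp h
  have hG0 : (0:ℤ) < 2 ^ G := by positivity
  have hV0 : (0:ℤ) ≤ V := by positivity
  have hsq : (2:ℤ) ^ (2 * G) = 2 ^ G * 2 ^ G := by rw [two_mul, pow_add]
  -- (1) `2G ≤ κ`
  have hκ' : 2 * G ≤ κ := by
    rcases hκ with h | h
    · exact h
    · have hV' : (2:ℤ) ^ m ≤ V := by exact_mod_cast h
      have h1 : (2:ℤ) ^ (m + 1 + G) ≤ M - 1 := by
        rw [hM, pow_add, pow_succ]; nlinarith [hG0, hV']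
      have h0 : (0:ℤ) ≤ 2 ^ (m + 1 + G) := by positivity
      have h2 : (2:ℤ) ^ (2 * (m + 1 + G)) ≤ (A : ℤ) * 2 ^ κ := by
        rw [two_mul, pow_add]; nlinarith [h1, h0]
      have h3 : (A : ℤ) * 2 ^ κ < 2 ^ (m + 1 + κ) := by
        rw [pow_add]; exact mul_lt_mul_of_pos_right hA (by positivity)
      have := two_pow_lt (h2.trans_lt h3)
      omega
  -- (2) `4^G ∣ Z - M² ≠ 0`
  obtain ⟨r, hr⟩ := Nat.exists_eq_add_of_le hκ'
  have hdvd : (2:ℤ) ^ (2 * G) ∣ (A : ℤ) * 2 ^ κ - M ^ 2 :=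
    dvd_sub ⟨(A : ℤ) * 2 ^ r, by rw [hr, pow_add]; ring⟩
      ⟨(2 * (V : ℤ) + 1) ^ 2, by rw [hM, hsq]; ring⟩
  obtain ⟨c, hc⟩ := hdvd
  have hc0 : c ≠ 0 := by
    rintro rfl
    exact hne (by linarith [hc])
  have hc1 : (1:ℤ) ≤ |c| := Int.one_le_abs hc0
  -- (3) `4^G ≤ |Z - M²| ≤ 2M + 1 < 2^(m+3+G)`
  have hD : |(A : ℤ) * 2 ^ κ - M ^ 2| ≤ 2 * M + 1 := by
    rw [abs_le]; constructor <;> nlinarith [hZlo, hZhi]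
  have hlow : (2:ℤ) ^ (2 * G) ≤ |(A : ℤ) * 2 ^ κ - M ^ 2| := by
    rw [hc, abs_mul, abs_of_pos (by positivity : (0:ℤ) < 2 ^ (2 * G))]
    nlinarith [hc1, (by positivity : (0:ℤ) < 2 ^ (2 * G))]
  have hup : 2 * M + 1 < (2:ℤ) ^ (m + 3 + G) := by
    rw [hM, show m + 3 + G = (m + 1) + 2 + G by ring, pow_add, pow_add]; nlinarith [hV, hG0]
  have key : (2:ℤ) ^ (2 * G) < 2 ^ (m + 3 + G) := lt_of_le_of_lt (hlow.trans hD) hup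
  have := two_pow_lt key
  omega

/-! ## §2 Rounding next to a value and at a finest-grid midpoint -/

/-- WITHIN HALF A QUANTUM OF A VALUE. Every value of `φ` is an integer multiple of the quantum, so
a rational within `quantum/2` of the value `n·quantum` rounds to it (no precision or range
hypothesis beyond representability of `n`). [folklore] -/
theorem toRat_roundNE_of_abs_lt_half {φ : Format} {x : ℚ} {n : ℕ} (hn : φ.Representable n)
    (h : |x - (n : ℚ) * φ.quantum| < φ.quantum / 2) :
    (roundNE φ x).toRat = (n : ℚ) * φ.quantum := by
  have hq := φ.quantum_pos
  refine toRat_roundNE_eq_of_forall_lt (exists_toRat_eq_natMul hn) fun y hy => ?_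
  have hyq : y.toRat = (y.toInt : ℚ) * φ.quantum := toRat_eq_toInt_mul y
  have hne : y.toInt ≠ (n : ℤ) := by
    intro h'; apply hy; rw [hyq, h']; push_cast; ring
  have hfar : φ.quantum ≤ |y.toRat - (n : ℚ) * φ.quantum| := by
    rw [hyq, ← sub_mul, abs_mul, abs_of_pos hq]
    have h1 : (1 : ℚ) ≤ |(y.toInt : ℚ) - n| := by
      rw [show (y.toInt : ℚ) - n = ((y.toInt - n : ℤ) : ℚ) by push_cast; ring, ← Int.cast_abs]
      exact_mod_cast Int.one_le_abs (sub_ne_zero.mpr hne)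
    nlinarith
  have htri : |y.toRat - (n : ℚ) * φ.quantum| ≤ |y.toRat - x| + |x - (n : ℚ) * φ.quantum| :=
    abs_sub_le _ _ _
  rw [abs_sub_comm y.toRat x] at htri
  linarith

/-- THE FINEST-GRID MIDPOINT WITH AN ODD LOWER NEIGHBOUR ROUNDS UP: for `t` odd with
`t + 1 ≤ 2^(m+1)` (the subnormal range and the first normal binade of `φ`, where the spacing is
one quantum) and `t + 1` in range, `fl_φ ((2t+1)·quantum/2) = (t+1)·quantum` (a tie; the lower
neighbour `t` quanta has an odd significand). Companion of `toRat_roundNE_gmid_odd` (normal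
binades). [folklore] -/
theorem toRat_roundNE_fine_mid_odd {φ : Format} (h1 : 1 ≤ φ.manBits) {t : ℕ} (ht : Odd t)
    (hthi : t + 1 ≤ 2 ^ (φ.manBits + 1)) (hu : t + 1 ≤ φ.maxScaled) :
    (roundNE φ (((2 * t + 1 : ℕ) : ℚ) * (φ.quantum / 2))).toRat =
      ((t + 1 : ℕ) : ℚ) * φ.quantum := by
  have hq := φ.quantum_pos
  have hr0 : φ.Representable t := representable_of_lt_pow (by omega) (by omega)
  have hru : φ.Representable (t + 1) := by
    rcases Nat.lt_or_ge (t + 1) (2 ^ (φ.manBits + 1)) with h | h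
    · exact representable_of_lt_pow h hu
    · have e : t + 1 = 2 ^ φ.manBits * 2 ^ 1 := by rw [pow_one]; omega
      rw [e]; exact representable_mul_pow (by
        exact Nat.pow_lt_pow_right (by norm_num) (by omega)) (by rw [← e]; exact hu)
  obtain ⟨v0, hv0⟩ := exists_toRat_eq_natMul hr0
  obtain ⟨yu, hyu⟩ := exists_toRat_eq_natMul hru
  set x := ((2 * t + 1 : ℕ) : ℚ) * (φ.quantum / 2) with hx
  have exv : x - v0.toRat = φ.quantum / 2 := by rw [hx, hv0]; push_cast; ring
  have exu : x - yu.toRat = -(φ.quantum / 2) := by rw [hx, hyu]; push_cast; ring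
  have hnear := roundNE_nearest (φ := φ) x yu
  rw [exu, abs_neg, abs_of_pos (by positivity : (0:ℚ) < φ.quantum / 2)] at hnear
  -- every value of `φ` is an integer number of quanta: `fl x ∈ {v0, yu}`
  have hor : (roundNE φ x).toRat = v0.toRat ∨ (roundNE φ x).toRat = yu.toRat := by
    set z := roundNE φ x with hz
    have hzq : z.toRat = (z.toInt : ℚ) * φ.quantum := toRat_eq_toInt_mul z
    rcases le_or_gt z.toInt (t : ℤ) with hle | hgt
    · left
      rcases hle.eq_or_lt with heq | hlt
      · rw [hzq, heq, hv0]; push_cast; ring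
      · exfalso
        have h' : (z.toInt : ℚ) + 1 ≤ t := by exact_mod_cast hlt
        rw [abs_of_nonneg (by rw [hzq, hx]; push_cast; nlinarith)] at hnear
        rw [hzq, hx] at hnear; push_cast at hnear; nlinarith
    · right
      have hge : (t : ℤ) + 1 ≤ z.toInt := hgt
      rcases hge.eq_or_lt with heq | hlt
      · rw [hzq, ← heq, hyu]; push_cast; ring
      · exfalso
        have h' : (t : ℚ) + 2 ≤ z.toInt := by exact_mod_cast hlt
        rw [abs_of_nonpos (by rw [hzq, hx]; push_cast; nlinarith)] at hnear
        rw [hzq, hx] at hnear; push_cast at hnear; nlinarith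
  rcases hor with h | h
  · exfalso
    have hev : 2 ∣ (roundNE φ x).man :=
      roundNE_man_even_of_tie h1 (y := yu) (by rw [h, exv, exu, abs_neg])
        (by rw [h]; intro heq; linarith)
    rw [two_dvd_man_iff h1] at hev
    have hS : (roundNE φ x).scaledMag = t := scaledMag_eq_of_toRat_eq (by rw [h, hv0])
    rw [hS] at hev
    have h2 : 2 ∣ t := dvd_trans (Dvd.intro _ rfl) hev
    obtain ⟨c, hc⟩ := ht
    omega
  · rw [h, hyu]

end Summit.Ventures.CertifiedArithmetic
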